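import Literature.Computability.Cryptography.RegevSamplerYBound
import Literature.Computability.Cryptography.RegevSamplerSlack
import Literature.Algebra.EuclideanLattices.RegevUSVPInstance
import HarnessLib

/-!
# Regev 2009, Lemma 3.14 in machine form: the numeric side conditions from parameter windows

Topic `Literature/Computability/Cryptography`, grouping namespace `Regev2009.SamplerRegs`; sequel of
`RegevSamplerMachine.lean`, `RegevSamplerYBound.lean`, `RegevSamplerSlack.lean`. The machine bound
`tvDist_machineCirc_le` carries a list of NUMERIC hypotheses on the instance `I`, the layout `Λ` and the width
`t` (`hd2`, `hRmin`, `hRdec`, `hfit`, `hδ`, `hC`, `hC2`, `hC0`, and — through the cosine machine — `hηc`,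
`c ≤ 1`, `1 ≤ S`, `2πBY ≤ 1`). This file discharges each of them from WINDOW conditions of the shape the
uniform family can guarantee per input length (Regev 2009, Lemma 3.14, proof: "all quantities are
`2^{poly(n)}`-bounded, so polynomially many bits of precision suffice"):

* the tail constant `tailC N = 16·2^{-N}` and `hδ_of_le_half`, `hC_of_le_half`, `tailC_le_half` (`N ≥ 5`),
  `tailC_nonneg`, with the smallness test `pi_mul_le_half` (`Y ≤ 1/16`, `2√N·Y ≤ 1/16`);
* `hd2_of_hd` (the promise `√N/t ≤ λ₁(L*)/2` gives `2√N ≤ t·λ₁(L*)`);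
* `hRmin_of` (`λ₁(L) ≥ 1` for a nonsingular integer lattice, `Regev2004.one_le_minNorm`);
* `hRdec_of` (`‖b∨ⱼ‖ ≤ 2^{e(2e+2)}`, `sum_norm_dualVec_le_two_pow_length`);
* `hfit_of` (`D_t ≤ 2^A`, `Y ≤ 1`, `√n + 2 ≤ 2^{B}`, `A + B + 1 ≤ ℓ`);
* `hηc_of`, `c_le_one_of`, `two_le_sq_of` (`2^j ≤ D_t`, `ℓ + 4 ≤ 2j`: the window BELOW `2^ℓ`);
* `hBY_of` (`2π·B·Y ≤ 1` from `2^j ≤ D_t`, `Y ≤ 2^{-j_B}` and `√n·2^ℓ ≤ 2^{j + j_B - 4}`).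

Everything here is proved; no named fact is introduced.

## References

* O. Regev, *On lattices, learning with errors, random linear codes, and cryptography*, J. ACM 56 (2009),
  art. 34, Lemma 3.14 (proof), Lemma 3.12 (proof), Claim 2.9 [Regev2009].
* D. Micciancio, S. Goldwasser, *Complexity of Lattice Problems*, Kluwer 2002, Ch. 1 §1.2 [MicciancioGoldwasser2002].
-/

noncomputable section

namespace Literature.Computability.Cryptography

namespace Regev2009

namespace SamplerRegs

open Literature.Algebra.EuclideanLattices Literature.Algebra.EuclideanLattices.Regev2009 Peikert2009 Finset Module
open scoped Real

/-! ### The tail constant -/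

/-- **The tail constant** `C = 16·2^{-N}` of the machine bound. [cite: Regev2009, Lemma 3.14 (proof)] -/
def tailC (N : ℕ) : ℝ := 16 * (2⁻¹ : ℝ) ^ N

/-- `0 ≤ C`. [folklore] -/
theorem tailC_nonneg (N : ℕ) : 0 ≤ tailC N := by unfold tailC; positivity

/-- `C ≤ 1/2` for `N ≥ 5`. [folklore] -/
theorem tailC_le_half {N : ℕ} (hN : 5 ≤ N) : tailC N ≤ 1 / 2 := by
  unfold tailC
  calc (16 : ℝ) * (2⁻¹ : ℝ) ^ N ≤ 16 * (2⁻¹ : ℝ) ^ 5 :=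
        mul_le_mul_of_nonneg_left (pow_le_pow_of_le_one (by norm_num) (by norm_num) hN) (by norm_num)
    _ = 1 / 2 := by norm_num

/-- **The smallness test**: `Y ≤ 1/16` and `2√N·Y ≤ 1/16` give `π(2√N·Y + Y²) ≤ 1/2`. [folklore] -/
theorem pi_mul_le_half {N : ℕ} {Y : ℝ} (hY0 : 0 ≤ Y) (hY : Y ≤ 16⁻¹) (hNY : 2 * Real.sqrt N * Y ≤ 16⁻¹) :
    π * (2 * Real.sqrt N * Y + Y ^ 2) ≤ 1 / 2 := by
  have hY2 : Y ^ 2 ≤ 16⁻¹ * 16⁻¹ := by rw [sq]; exact mul_le_mul hY hY hY0 (by norm_num)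
  have hs : 2 * Real.sqrt N * Y + Y ^ 2 ≤ 16⁻¹ + 16⁻¹ * 16⁻¹ := add_le_add hNY hY2
  have hs0 : 0 ≤ 2 * Real.sqrt N * Y + Y ^ 2 := by positivity
  calc π * (2 * Real.sqrt N * Y + Y ^ 2) ≤ 3.15 * (16⁻¹ + 16⁻¹ * 16⁻¹) :=
        mul_le_mul Real.pi_lt_d2.le hs hs0 (by norm_num)
    _ ≤ 1 / 2 := by norm_num

/-- **`hδ`** from the smallness. [folklore] -/
theorem hδ_of_le_half {N : ℕ} {Y : ℝ} (h : π * (2 * Real.sqrt N * Y + Y ^ 2) ≤ 1 / 2) :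
    π * (2 * Real.sqrt N * Y + Y ^ 2) < 1 := by linarith

/-- **`hC`** with `C = 16·2^{-N}` from the smallness and `2πBY ≤ 1` (`N ≥ 1`):
`e^{2πBY}·2^{-N} ≤ C·(1 − π(2√N Y + Y²))(1 − b₁ᴺ)(1 − 4^{-N})`. [cite: Regev2009, Lemma 3.14 (proof)] -/
theorem hC_of_le_half {N : ℕ} (hN : 1 ≤ N) {Y B : ℝ} (h : π * (2 * Real.sqrt N * Y + Y ^ 2) ≤ 1 / 2)
    (hBY : 2 * π * B * Y ≤ 1) :
    Real.exp (2 * π * B * Y) * (2⁻¹ : ℝ) ^ N ≤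
      tailC N * ((1 - π * (2 * Real.sqrt N * Y + Y ^ 2)) * (1 - banaConst ^ N) * (1 - (4⁻¹ : ℝ) ^ N)) := by
  have hX : 0 ≤ (2⁻¹ : ℝ) ^ N := by positivity
  have he : Real.exp (2 * π * B * Y) ≤ 3 :=
    (Real.exp_le_exp.2 hBY).trans (Real.exp_one_lt_d9.le.trans (by norm_num))
  have h1 : 1 / 2 ≤ 1 - π * (2 * Real.sqrt N * Y + Y ^ 2) := by linarith
  have hb : banaConst ^ N ≤ 1 / 2 :=
    (banaConst_pow_le N).trans ((pow_le_pow_of_le_one (by norm_num) (by norm_num) hN).trans (by norm_num))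
  have h2 : 1 / 2 ≤ 1 - banaConst ^ N := by linarith
  have h4 : (4⁻¹ : ℝ) ^ N ≤ 1 / 4 := (pow_le_pow_of_le_one (by norm_num) (by norm_num) hN).trans (by norm_num)
  have h3 : 3 / 4 ≤ 1 - (4⁻¹ : ℝ) ^ N := by linarith
  have h12 : 1 / 2 * (1 / 2) ≤ (1 - π * (2 * Real.sqrt N * Y + Y ^ 2)) * (1 - banaConst ^ N) :=
    mul_le_mul h1 h2 (by norm_num) (by linarith)
  have hP : 1 / 2 * (1 / 2) * (3 / 4) ≤ (1 - π * (2 * Real.sqrt N * Y + Y ^ 2)) * (1 - banaConst ^ N) * (1 - (4⁻¹ : ℝ) ^ N) :=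
    mul_le_mul h12 h3 (by norm_num) ((by norm_num : (0 : ℝ) ≤ 1 / 2 * (1 / 2)).trans h12)
  calc Real.exp (2 * π * B * Y) * (2⁻¹ : ℝ) ^ N ≤ 3 * (2⁻¹ : ℝ) ^ N := mul_le_mul_of_nonneg_right he hX
    _ = tailC N * (1 / 2 * (1 / 2) * (3 / 4)) := by unfold tailC; ring
    _ ≤ _ := mul_le_mul_of_nonneg_left hP (tailC_nonneg N)

/-! ### The promise -/

/-- **`hd2` from `hd`**: `√N/t ≤ λ/2` and `0 < t` give `2√N ≤ t·λ`. [folklore] -/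
theorem hd2_of_hd {N : ℕ} {t lam : ℝ} (ht : 0 < t) (hd : Real.sqrt N / t ≤ lam / 2) : 2 * Real.sqrt N ≤ t * lam := by
  rw [div_le_iff₀ ht] at hd
  linarith

/-! ### The grid scale windows -/

variable {W : ℕ} (I : LatticeInstance) (Λ : SamplerClassical.Layout W I.n)

/-- **`hRmin`**: `2√N·t ≤ R` gives `2√N·t ≤ R·λ₁(L)` for a nonsingular integer lattice (`λ₁(L) ≥ 1`).
[cite: MicciancioGoldwasser2002, Ch. 1 §1.2] -/
theorem hRmin_of (hI : I.IsNonsingular) (hn : 1 ≤ I.n) {t : ℝ} {R : ℕ}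
    (h : 2 * Real.sqrt (finrank ℝ (EuclideanSpace ℝ (Fin I.n))) * t ≤ (R : ℝ)) :
    2 * Real.sqrt (finrank ℝ (EuclideanSpace ℝ (Fin I.n))) * t ≤ (R : ℝ) * minNorm I.lattice :=
  h.trans (le_mul_of_one_le_right (Nat.cast_nonneg R) (Regev2004.one_le_minNorm hI hn))

/-- **`hRdec`**: `2|t|√N ≤ 2^{j₀}` and `e(2e+2) + j₀ ≤ ℓ_R` give `2|t|√N·‖b∨ⱼ‖ ≤ 2^{ℓ_R}` for every `j`
(`‖b∨ⱼ‖ ≤ 2^{e(2e+2)}`, `e = |code B|`). [cite: Regev2009, Lemma 3.14 (proof)] [cite: MicciancioGoldwasser2002, Ch. 1 §1.2] -/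
theorem hRdec_of [IsZLattice ℝ I.lattice] {t : ℝ} {j₀ : ℕ} (hj₀ : 2 * |t| * Real.sqrt (finrank ℝ (EuclideanSpace ℝ (Fin I.n))) ≤ (2 : ℝ) ^ j₀)
    (hℓR : I.encode.length * (2 * I.encode.length + 2) + j₀ ≤ Λ.ℓR) (j : Fin I.n) :
    2 * |t| * Real.sqrt (finrank ℝ (EuclideanSpace ℝ (Fin I.n))) * ‖dualVec I j‖ ≤ ((2 ^ Λ.ℓR : ℕ) : ℝ) := by
  have h1 : ‖dualVec I j‖ ≤ (2 : ℝ) ^ (I.encode.length * (2 * I.encode.length + 2)) :=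
    (single_le_sum (f := fun i => ‖dualVec I i‖) (fun i _ => norm_nonneg _) (mem_univ j)).trans
      (sum_norm_dualVec_le_two_pow_length I)
  calc 2 * |t| * Real.sqrt (finrank ℝ (EuclideanSpace ℝ (Fin I.n))) * ‖dualVec I j‖
      ≤ (2 : ℝ) ^ j₀ * (2 : ℝ) ^ (I.encode.length * (2 * I.encode.length + 2)) := mul_le_mul hj₀ h1 (norm_nonneg _) (by positivity)
    _ = (2 : ℝ) ^ (I.encode.length * (2 * I.encode.length + 2) + j₀) := by rw [pow_add, mul_comm]
    _ ≤ (2 : ℝ) ^ Λ.ℓR := pow_le_pow_right₀ one_le_two hℓR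
    _ = ((2 ^ Λ.ℓR : ℕ) : ℝ) := by norm_num

/-- **`hfit`**: `D_t ≤ 2^A`, `0 ≤ Y ≤ 1`, `√n + 2 ≤ 2^B` and `A + B + 1 ≤ ℓ` give `D_t(√n + Y) + 1 ≤ 2^{ℓ−1}`.
[cite: Regev2009, Lemma 3.14 (proof)] -/
theorem hfit_of {D Y : ℝ} {n A B ℓ : ℕ} (hD : D ≤ (2 : ℝ) ^ A) (hY0 : 0 ≤ Y) (hY : Y ≤ 1)
    (hn : Real.sqrt n + 2 ≤ (2 : ℝ) ^ B) (hℓ : A + B + 1 ≤ ℓ) :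
    D * (Real.sqrt n + Y) + 1 ≤ (2 : ℝ) ^ (ℓ - 1) := by
  have hA1 : (1 : ℝ) ≤ 2 ^ A := one_le_pow₀ one_le_two
  have hs0 : 0 ≤ Real.sqrt n := Real.sqrt_nonneg _
  calc D * (Real.sqrt n + Y) + 1 ≤ 2 ^ A * (Real.sqrt n + 1) + 2 ^ A * 1 :=
        add_le_add (mul_le_mul hD (by linarith) (by positivity) (by positivity)) (by linarith)
    _ = 2 ^ A * (Real.sqrt n + 2) := by ring
    _ ≤ 2 ^ A * 2 ^ B := mul_le_mul_of_nonneg_left hn (by positivity)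
    _ = 2 ^ (A + B) := by rw [pow_add]
    _ ≤ (2 : ℝ) ^ (ℓ - 1) := pow_le_pow_right₀ one_le_two (by omega)

/-- **`hηc`**: `2^j ≤ D_t` and `ℓ + 4 ≤ 2j` give `c·(2·2^ℓ + 1) ≤ 2` for `c = 2π/D_t²` (the window below `2^ℓ`).
[cite: Regev2009, Lemma 3.12 (proof)] -/
theorem hηc_of {D : ℝ} {j ℓ : ℕ} (hD : (2 : ℝ) ^ j ≤ D) (hj : ℓ + 4 ≤ 2 * j) :
    2 * π / D ^ 2 * (2 * 2 ^ ℓ + 1) ≤ 2 := by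
  have hD0 : 0 < D := lt_of_lt_of_le (by positivity) hD
  have hD2 : (2 : ℝ) ^ (ℓ + 4) ≤ D ^ 2 :=
    (pow_le_pow_right₀ one_le_two hj).trans (by rw [pow_mul']; exact pow_le_pow_left₀ (by positivity) hD 2)
  rw [pow_add] at hD2
  rw [div_mul_eq_mul_div, div_le_iff₀ (by positivity)]
  have h1 : (1 : ℝ) ≤ 2 ^ ℓ := one_le_pow₀ one_le_two
  nlinarith [Real.pi_lt_d2, Real.pi_pos]

/-- **`c ≤ 1`**: `2^j ≤ D_t` with `2 ≤ j` gives `2π/D_t² ≤ 1`. [folklore] -/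
theorem c_le_one_of {D : ℝ} {j : ℕ} (hD : (2 : ℝ) ^ j ≤ D) (hj : 2 ≤ j) : 2 * π / D ^ 2 ≤ 1 := by
  have h4 : (4 : ℝ) ≤ D := le_trans (by
    calc (4 : ℝ) = 2 ^ 2 := by norm_num
      _ ≤ 2 ^ j := pow_le_pow_right₀ one_le_two hj) hD
  have hD0 : 0 < D := by linarith
  rw [div_le_one (by positivity)]
  nlinarith [Real.pi_lt_d2]

/-- **`1 ≤ S`** for `S = D_t²/2`: `2^j ≤ D_t` with `1 ≤ j` gives `2 ≤ D_t²`. [folklore] -/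
theorem two_le_sq_of {D : ℝ} {j : ℕ} (hD : (2 : ℝ) ^ j ≤ D) (hj : 1 ≤ j) : 2 ≤ D ^ 2 := by
  have h2 : (2 : ℝ) ≤ D := le_trans (by
    calc (2 : ℝ) = 2 ^ 1 := by norm_num
      _ ≤ 2 ^ j := pow_le_pow_right₀ one_le_two hj) hD
  nlinarith

/-- **`2πBY ≤ 1`** for `B = √n·2^ℓ/D_t + Y`: from `2^j ≤ D_t`, `0 ≤ Y ≤ 2^{-j_B}`,
`√n·2^ℓ·2^{-j}·2^{-j_B} ≤ 1/16` and `2^{-j_B} ≤ 1/16`. [cite: Regev2009, Lemma 3.14 (proof)] -/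
theorem hBY_of {D Y : ℝ} {n ℓ j jB : ℕ} (hD : (2 : ℝ) ^ j ≤ D) (hY0 : 0 ≤ Y) (hY : Y ≤ (2⁻¹ : ℝ) ^ jB)
    (h1 : Real.sqrt n * 2 ^ ℓ * (2⁻¹ : ℝ) ^ j * (2⁻¹ : ℝ) ^ jB ≤ 16⁻¹) (h2 : (2⁻¹ : ℝ) ^ jB ≤ 16⁻¹) :
    2 * π * (Real.sqrt n * (2 ^ ℓ / D) + Y) * Y ≤ 1 := by
  have hD0 : 0 < D := lt_of_lt_of_le (by positivity) hD
  have hs0 : 0 ≤ Real.sqrt n := Real.sqrt_nonneg _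
  have hq : (2 : ℝ) ^ ℓ / D ≤ 2 ^ ℓ * (2⁻¹ : ℝ) ^ j := by
    rw [inv_pow, ← div_eq_mul_inv]
    exact div_le_div_of_nonneg_left (by positivity) (by positivity) hD
  have hB : Real.sqrt n * (2 ^ ℓ / D) + Y ≤ Real.sqrt n * (2 ^ ℓ * (2⁻¹ : ℝ) ^ j) + (2⁻¹ : ℝ) ^ jB :=
    add_le_add (mul_le_mul_of_nonneg_left hq hs0) hY
  have hB0 : 0 ≤ Real.sqrt n * (2 ^ ℓ / D) + Y := by positivity
  have hBY : (Real.sqrt n * (2 ^ ℓ / D) + Y) * Y ≤ 16⁻¹ + 16⁻¹ * 16⁻¹ := by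
    calc (Real.sqrt n * (2 ^ ℓ / D) + Y) * Y
        ≤ (Real.sqrt n * (2 ^ ℓ * (2⁻¹ : ℝ) ^ j) + (2⁻¹ : ℝ) ^ jB) * (2⁻¹ : ℝ) ^ jB := mul_le_mul hB hY hY0 (by positivity)
      _ = Real.sqrt n * 2 ^ ℓ * (2⁻¹ : ℝ) ^ j * (2⁻¹ : ℝ) ^ jB + (2⁻¹ : ℝ) ^ jB * (2⁻¹ : ℝ) ^ jB := by ring
      _ ≤ 16⁻¹ + 16⁻¹ * 16⁻¹ := add_le_add h1 (mul_le_mul h2 h2 (by positivity) (by norm_num))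
  calc 2 * π * (Real.sqrt n * (2 ^ ℓ / D) + Y) * Y = 2 * π * ((Real.sqrt n * (2 ^ ℓ / D) + Y) * Y) := by ring
    _ ≤ 2 * 3.15 * (16⁻¹ + 16⁻¹ * 16⁻¹) := by
        have := Real.pi_lt_d2
        exact mul_le_mul (by linarith) hBY (mul_nonneg hB0 hY0) (by positivity)
    _ ≤ 1 := by norm_num

end SamplerRegs

end Regev2009

end Literature.Computability.Cryptography

end
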